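import Summits.BirchSwinnertonDyer.Rank1Residual.X10.SelfTwistThetaFreeRecordsC
import Summits.BirchSwinnertonDyer.Rank1Residual.X10.SelfTwistThetaFreeRecordsD
import Summits.BirchSwinnertonDyer.Rank1Residual.X10.SelfTwistThetaFreeRecordsE
import Literature.NumberTheory.EllipticCurves.Rank1Residual.Typed.X10bHeegnerIndexCertificate
import Summits.BirchSwinnertonDyer.Rank1Residual.AdditivePotMult.RankZeroShaEightyOneCertificateIntModel
import Summits.BirchSwinnertonDyer.Rank1Residual.AdditivePotMult.TwistSupplyJClass
import HarnessLib

/-!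
# N2 (X10b @ 3): `BSD(E,3)` for the self-twist Ш-cells by the CHA ROUTE with the `3`-descent line REPLACED by the kernel
# visibility theorem — file B: `327184dt1`, `395641f1`, `322624k1`, `305762d1` (cell `b2b-bsdres`, unit `b2b-bsdres-x10` = N2 class lead, GEN 23; per-pair RECORDS; close nothing new)

HONEST FRAMING (cell `b2b-bsdres`, run/shared/lean/b2b/bsd-rank1-residual/, verbatim in every
file): the goal of the cell is to DELETE the COMBINATION-SHAPED residual classes of the
Birch–Swinnerton-Dyer formula for ALL analytic-rank `≤ 1` elliptic curves over `ℚ` — "full BSD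
formula for every rank `≤ 1` curve in class `C`" assembled STRICTLY from published theorems — so
that the rank-`≤ 1` remainder becomes exactly the CONSTRUCTION-SHAPED classes, which are TYPED
(missing-input `Prop`s), NOT attempted. This is not "finishing BSD". Class X10b (= N2) stays
CONSTRUCTION-SHAPED (NEEDS `X_A3`); PER-PAIR records; nothing booked; no mark / label / tier / count
changed. Theorems only (no definition, no named fact of ours, no `sorry`).

## What

The RESISTANT rank-0 N2 cells with `#Ш_an = 9` are closed per pair by the Cha route
`Typed.X10.bsdp_three_rankZero_of_cha_of_selmerThree_ne_bot` (x10 g6 / x10b g2; GZK + Cassels–Tate + Cha 2005)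
from TWO finite certificates: the Heegner-index certificate `ord₃ [E(K) : ℤ·y_K] ≤ 1` (UPPER bound) and the 3-descent
line `Sel^(3)(E/ℚ) ≠ 0` (LOWER bound) — data rows `Theorems/Rank1ResidualX10bHeegnerIndexRecords.lean`.  For the nine
SELF-TWIST Ш-cells the LOWER bound is now a KERNEL THEOREM (`X10/SelfTwistThetaFreeRecords{A..E}.lean`, x10 GEN 23:
`Ш(E)[3] ∋ c ≠ 0` from the rank-2 twin with θ (dual Hesse certificate) and rank (RED-pair) in the kernel).  THIS FILE
composes the two: per cell `bsdp_three_selfTwist_cha_kernel_v<E> : BSDp E 3` and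
`padicValNat_shaOrder_eq_two_selfTwist_cha_kernel_v<E> : ord₃ #Ш(E) = 2` through the class-free
`Typed.bsdp_of_cha_of_casselsTate_of_dvd` / `Typed.padicValNat_shaOrder_eq_of_cha_of_casselsTate_of_dvd` (k = 1), with
`3 ∣ #Ш(E)` from the visibility record (`dvd_shaOrder_of_exists_torsion`), `Irr E 3` from the record's Frobenius-count
numerals, and `¬ E.HasCM` IN THE KERNEL from `ord_q j(E) < 0` at a potentially multiplicative prime `q`
(additive-p lineage `AdditivePotMult.padicValRat_j_lt_zero_of_intModel` + `not_hasCM_of_padicValRat_j_neg`; the tree theorem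
`hasCM_iff_j_mem_holds`).  BINDERS LEFT (displayed): PUBLISHED `hGZK` `hCT` `hCha` (+ `hU`/`hU2` Tate uniformisation where the
visibility record has them); the class condition `hr : r_an(E) = 0`; the Heegner datum `(K, N, P)` with `hK hH hP hnt h3D h9N` and
the ONE finite certificate `hIdx` (x10b `heegidx`, two engines); `hq`/`hv`.  So on these nine pairs `BSD(E,3)` needs ONE certificate
(the index), not two.  Generator `HOME/b2b-bsdres-x10/g23/gen/cha_twin.py`.

References: [Miller2011LMS] Thm. 5.2, Def. 1.1; [GrigorovJorzaPatrikisSteinTarnita2009] Prop. 3.35; [SilvermanAEC2009] X.4.14,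
App. C §11; [CremonaMazur2000] §3; [Fisher2012Hessian] §13; [Cremona2006] Table 1.
-/

set_option autoImplicit false

noncomputable section

open scoped Classical NumberField
open IsDedekindDomain NumberField WeierstrassCurve Rat.HeightOneSpectrum
  Literature.NumberTheory.EllipticCurves Literature.NumberTheory.EllipticCurves.ModularForms
  Literature.NumberTheory.EllipticCurves.Rank1Residual
  Literature.NumberTheory.EllipticCurves.Rank1Residual.Typed
  Literature.NumberTheory.GaloisRepresentations
  Summit.BirchSwinnertonDyer.BirchSwinnertonDyer.Rank1Residual.IntModel
  Summit.BirchSwinnertonDyer.Rank1Residual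
  Summit.BirchSwinnertonDyer.Rank1Residual.GaloisImage
  Summit.BirchSwinnertonDyer.Rank1Residual.Additive
  Summit.BirchSwinnertonDyer.Rank1Residual.X11b

namespace Summit.BirchSwinnertonDyer.Rank1Residual.X10.SelfTwist

/-! ### `327184dt1` — BSD(E,3) by the Cha route with the descent line replaced by the kernel visibility theorem (`ord_2 j(E) < 0` ⇒ non-CM) -/

/-- **`BSD(E,3)` for the N2 self-twist Ш-cell `327184dt1` from ONE finite certificate (the Heegner index) — the `3`-descent line is NO
LONGER an input**: `Typed.bsdp_of_cha_of_casselsTate_of_dvd` (Cha 2005 / Miller 2011 Thm. 5.2 upper bound from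
`ord₃ [E(K) : ℤ·y_K] ≤ 1`; Cassels–Tate lower bound from `3 ∣ #Ш(E)`) with `3 ∣ #Ш(E)` SUPPLIED IN THE KERNEL by the θ-free,
rank-in-kernel visibility record `exists_sha_three_selfTwist_kernel_v327184dt1` (`X10/SelfTwistThetaFreeRecordsC.lean`, x10 GEN 23), `E[3]`
irreducible by the record's Frobenius counts, and `E` non-CM because `ord_2 j(E) < 0` (`AdditivePotMult.not_hasCM_of_padicValRat_j_neg`,
kernel). Binders left (displayed): PUBLISHED `hGZK` `hCT` `hCha`; the class condition `hr`; the Heegner datum `hK hH hP hnt h3D h9N`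
with the index certificate `hIdx` (x10b `heegidx`, two engines; X10B-HEEGIDX.md); `hq`/`hv` (`#Ш_an = 9·unit`). Per pair; closes nothing new
(the lane's Cha records `Theorems/Rank1ResidualX10bHeegnerIndexRecords.lean` carry the same pair with BOTH certificates); nothing booked; N2 mark
unchanged. [cite: Miller2011LMS, Thm. 5.2 and Def. 1.1] [cite: SilvermanAEC2009, Thm. X.4.14 and App. C §11] [cite: Fisher2012Hessian, §13] [cite: Cremona2006, Table 1 (label 327184dt1)] -/
theorem bsdp_three_selfTwist_cha_kernel_v327184dt1
    (hGZK : rank_eq_analyticRank_of_analyticRank_le_one)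
    (hCT : exists_casselsTate_pairing (K := ℚ)) (hCha : Cha2005.thm52_padicValNat_shaOrder_le)
    (W : WeierstrassCurve ℚ) [W.IsElliptic] [W.IsGloballyMinimal]
    (hI : integralModelInt W = ⟨0, 1, 0, 974736, -1134484012⟩) (hr : W.analyticRank = 0)
    {N : ℕ} [NeZero N] {K : Type} [Field K] [NumberField K] (hK : IsImaginaryQuadratic K)
    (hH : SatisfiesHeegnerHypothesis N K) {P : (W.baseChange K).toAffine.Point}
    (hP : IsHeegnerPoint N W K P) (hnt : ¬ IsOfFinAddOrder P)
    (h3D : ¬ (3 : ℤ) ∣ NumberField.discr K) (h9N : ¬ 3 ^ 2 ∣ N)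
    (hIdx : padicValNat 3 (AddSubgroup.zmultiples P).index ≤ 1)
    {q : ℚ} (hq : shaAn W = (q : ℂ)) (hv : padicValRat 3 q = 2) :
    BSDp W 3 := by
  haveI : Fact (Nat.Prime 2) := ⟨Nat.prime_two⟩
  haveI : Fact (Nat.Prime 7) := ⟨by norm_num⟩
  have hirr : W.HasIrreducibleModPGaloisRep 3 :=
    hasIrreducibleModPGaloisRep_of_intModel_of_noroot hI 3 7 (by norm_num) (by decide +kernel)
      Summit.BirchSwinnertonDyer.Rank1Residual.X10.card_t327184dt1_7 noroot3_frob_v322624k1_7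
  have hcm : ¬ W.HasCM :=
    AdditivePotMult.not_hasCM_of_padicValRat_j_neg
      (AdditivePotMult.padicValRat_j_lt_zero_of_intModel hI 2 12 (by decide +kernel) (by decide +kernel))
  have hvis := exists_sha_three_selfTwist_kernel_v327184dt1  hGZK W hI hr
  exact Typed.bsdp_of_cha_of_casselsTate_of_dvd W 3 hGZK hCT hCha hcm (by rw [hr]; norm_num) hK hH hP hnt
    (by decide) h3D h9N hirr (k := 1) hIdx hq (by rw [hv]; norm_num)
    (by simpa using dvd_shaOrder_of_exists_torsion W 3 hvis)

/-- **`ord₃ #Ш(327184dt1) = 2` exactly** under the same data (Cha's upper bound from the index certificate; the lower bound IN THE KERNEL from the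
self-twist visibility record and Cassels–Tate). [cite: Miller2011LMS, Thm. 5.2] [cite: SilvermanAEC2009, Thm. X.4.14] -/
theorem padicValNat_shaOrder_eq_two_selfTwist_cha_kernel_v327184dt1
    (hGZK : rank_eq_analyticRank_of_analyticRank_le_one)
    (hCT : exists_casselsTate_pairing (K := ℚ)) (hCha : Cha2005.thm52_padicValNat_shaOrder_le)
    (W : WeierstrassCurve ℚ) [W.IsElliptic] [W.IsGloballyMinimal]
    (hI : integralModelInt W = ⟨0, 1, 0, 974736, -1134484012⟩) (hr : W.analyticRank = 0)
    {N : ℕ} [NeZero N] {K : Type} [Field K] [NumberField K] (hK : IsImaginaryQuadratic K)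
    (hH : SatisfiesHeegnerHypothesis N K) {P : (W.baseChange K).toAffine.Point}
    (hP : IsHeegnerPoint N W K P) (hnt : ¬ IsOfFinAddOrder P)
    (h3D : ¬ (3 : ℤ) ∣ NumberField.discr K) (h9N : ¬ 3 ^ 2 ∣ N)
    (hIdx : padicValNat 3 (AddSubgroup.zmultiples P).index ≤ 1) :
    padicValNat 3 W.shaOrder = 2 := by
  haveI : Fact (Nat.Prime 2) := ⟨Nat.prime_two⟩
  haveI : Fact (Nat.Prime 7) := ⟨by norm_num⟩
  have hirr : W.HasIrreducibleModPGaloisRep 3 :=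
    hasIrreducibleModPGaloisRep_of_intModel_of_noroot hI 3 7 (by norm_num) (by decide +kernel)
      Summit.BirchSwinnertonDyer.Rank1Residual.X10.card_t327184dt1_7 noroot3_frob_v322624k1_7
  have hcm : ¬ W.HasCM :=
    AdditivePotMult.not_hasCM_of_padicValRat_j_neg
      (AdditivePotMult.padicValRat_j_lt_zero_of_intModel hI 2 12 (by decide +kernel) (by decide +kernel))
  have hvis := exists_sha_three_selfTwist_kernel_v327184dt1  hGZK W hI hr
  simpa using Typed.padicValNat_shaOrder_eq_of_cha_of_casselsTate_of_dvd W 3 hGZK hCT hCha hcm (by rw [hr]; norm_num) hK hH hP hnt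
    (by decide) h3D h9N hirr (k := 1) hIdx (by simpa using dvd_shaOrder_of_exists_torsion W 3 hvis)

/-! ### `395641f1` — BSD(E,3) by the Cha route with the descent line replaced by the kernel visibility theorem (`ord_17 j(E) < 0` ⇒ non-CM) -/

/-- **`BSD(E,3)` for the N2 self-twist Ш-cell `395641f1` from ONE finite certificate (the Heegner index) — the `3`-descent line is NO
LONGER an input**: `Typed.bsdp_of_cha_of_casselsTate_of_dvd` (Cha 2005 / Miller 2011 Thm. 5.2 upper bound from
`ord₃ [E(K) : ℤ·y_K] ≤ 1`; Cassels–Tate lower bound from `3 ∣ #Ш(E)`) with `3 ∣ #Ш(E)` SUPPLIED IN THE KERNEL by the θ-free,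
rank-in-kernel visibility record `exists_sha_three_selfTwist_kernel_v395641f1` (`X10/SelfTwistThetaFreeRecordsD.lean`, x10 GEN 23), `E[3]`
irreducible by the record's Frobenius counts, and `E` non-CM because `ord_17 j(E) < 0` (`AdditivePotMult.not_hasCM_of_padicValRat_j_neg`,
kernel). Binders left (displayed): PUBLISHED `hGZK` `hCT` `hCha`; the class condition `hr`; the Heegner datum `hK hH hP hnt h3D h9N`
with the index certificate `hIdx` (x10b `heegidx`, two engines; X10B-HEEGIDX.md); `hq`/`hv` (`#Ш_an = 9·unit`). Per pair; closes nothing new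
(the lane's Cha records `Theorems/Rank1ResidualX10bHeegnerIndexRecords.lean` carry the same pair with BOTH certificates); nothing booked; N2 mark
unchanged. [cite: Miller2011LMS, Thm. 5.2 and Def. 1.1] [cite: SilvermanAEC2009, Thm. X.4.14 and App. C §11] [cite: Fisher2012Hessian, §13] [cite: Cremona2006, Table 1 (label 395641f1)] -/
theorem bsdp_three_selfTwist_cha_kernel_v395641f1
    (hGZK : rank_eq_analyticRank_of_analyticRank_le_one)
    (hCT : exists_casselsTate_pairing (K := ℚ)) (hCha : Cha2005.thm52_padicValNat_shaOrder_le)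
    (W : WeierstrassCurve ℚ) [W.IsElliptic] [W.IsGloballyMinimal]
    (hI : integralModelInt W = ⟨0, 1, 1, -24934614623, -1515437094749663⟩) (hr : W.analyticRank = 0)
    {N : ℕ} [NeZero N] {K : Type} [Field K] [NumberField K] (hK : IsImaginaryQuadratic K)
    (hH : SatisfiesHeegnerHypothesis N K) {P : (W.baseChange K).toAffine.Point}
    (hP : IsHeegnerPoint N W K P) (hnt : ¬ IsOfFinAddOrder P)
    (h3D : ¬ (3 : ℤ) ∣ NumberField.discr K) (h9N : ¬ 3 ^ 2 ∣ N)
    (hIdx : padicValNat 3 (AddSubgroup.zmultiples P).index ≤ 1)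
    {q : ℚ} (hq : shaAn W = (q : ℂ)) (hv : padicValRat 3 q = 2) :
    BSDp W 3 := by
  haveI : Fact (Nat.Prime 13) := ⟨by norm_num⟩
  haveI : Fact (Nat.Prime 17) := ⟨by norm_num⟩
  have hirr : W.HasIrreducibleModPGaloisRep 3 :=
    hasIrreducibleModPGaloisRep_of_intModel_of_noroot hI 3 13 (by norm_num) (by decide +kernel)
      card_t395641f1_13 noroot3_frob_13_20
  have hcm : ¬ W.HasCM :=
    AdditivePotMult.not_hasCM_of_padicValRat_j_neg
      (AdditivePotMult.padicValRat_j_lt_zero_of_intModel hI 17 6 (by decide +kernel) (by decide +kernel))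
  have hvis := exists_sha_three_selfTwist_kernel_v395641f1  hGZK W hI hr
  exact Typed.bsdp_of_cha_of_casselsTate_of_dvd W 3 hGZK hCT hCha hcm (by rw [hr]; norm_num) hK hH hP hnt
    (by decide) h3D h9N hirr (k := 1) hIdx hq (by rw [hv]; norm_num)
    (by simpa using dvd_shaOrder_of_exists_torsion W 3 hvis)

/-- **`ord₃ #Ш(395641f1) = 2` exactly** under the same data (Cha's upper bound from the index certificate; the lower bound IN THE KERNEL from the
self-twist visibility record and Cassels–Tate). [cite: Miller2011LMS, Thm. 5.2] [cite: SilvermanAEC2009, Thm. X.4.14] -/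
theorem padicValNat_shaOrder_eq_two_selfTwist_cha_kernel_v395641f1
    (hGZK : rank_eq_analyticRank_of_analyticRank_le_one)
    (hCT : exists_casselsTate_pairing (K := ℚ)) (hCha : Cha2005.thm52_padicValNat_shaOrder_le)
    (W : WeierstrassCurve ℚ) [W.IsElliptic] [W.IsGloballyMinimal]
    (hI : integralModelInt W = ⟨0, 1, 1, -24934614623, -1515437094749663⟩) (hr : W.analyticRank = 0)
    {N : ℕ} [NeZero N] {K : Type} [Field K] [NumberField K] (hK : IsImaginaryQuadratic K)
    (hH : SatisfiesHeegnerHypothesis N K) {P : (W.baseChange K).toAffine.Point}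
    (hP : IsHeegnerPoint N W K P) (hnt : ¬ IsOfFinAddOrder P)
    (h3D : ¬ (3 : ℤ) ∣ NumberField.discr K) (h9N : ¬ 3 ^ 2 ∣ N)
    (hIdx : padicValNat 3 (AddSubgroup.zmultiples P).index ≤ 1) :
    padicValNat 3 W.shaOrder = 2 := by
  haveI : Fact (Nat.Prime 13) := ⟨by norm_num⟩
  haveI : Fact (Nat.Prime 17) := ⟨by norm_num⟩
  have hirr : W.HasIrreducibleModPGaloisRep 3 :=
    hasIrreducibleModPGaloisRep_of_intModel_of_noroot hI 3 13 (by norm_num) (by decide +kernel)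
      card_t395641f1_13 noroot3_frob_13_20
  have hcm : ¬ W.HasCM :=
    AdditivePotMult.not_hasCM_of_padicValRat_j_neg
      (AdditivePotMult.padicValRat_j_lt_zero_of_intModel hI 17 6 (by decide +kernel) (by decide +kernel))
  have hvis := exists_sha_three_selfTwist_kernel_v395641f1  hGZK W hI hr
  simpa using Typed.padicValNat_shaOrder_eq_of_cha_of_casselsTate_of_dvd W 3 hGZK hCT hCha hcm (by rw [hr]; norm_num) hK hH hP hnt
    (by decide) h3D h9N hirr (k := 1) hIdx (by simpa using dvd_shaOrder_of_exists_torsion W 3 hvis)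

/-! ### `322624k1` — BSD(E,3) by the Cha route with the descent line replaced by the kernel visibility theorem (`ord_2 j(E) < 0` ⇒ non-CM) -/

/-- **`BSD(E,3)` for the N2 self-twist Ш-cell `322624k1` from ONE finite certificate (the Heegner index) — the `3`-descent line is NO
LONGER an input**: `Typed.bsdp_of_cha_of_casselsTate_of_dvd` (Cha 2005 / Miller 2011 Thm. 5.2 upper bound from
`ord₃ [E(K) : ℤ·y_K] ≤ 1`; Cassels–Tate lower bound from `3 ∣ #Ш(E)`) with `3 ∣ #Ш(E)` SUPPLIED IN THE KERNEL by the θ-free,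
rank-in-kernel visibility record `exists_sha_three_selfTwist_kernel_v322624k1` (`X10/SelfTwistThetaFreeRecordsD.lean`, x10 GEN 23), `E[3]`
irreducible by the record's Frobenius counts, and `E` non-CM because `ord_2 j(E) < 0` (`AdditivePotMult.not_hasCM_of_padicValRat_j_neg`,
kernel). Binders left (displayed): PUBLISHED `hGZK` `hCT` `hCha`; the class condition `hr`; the Heegner datum `hK hH hP hnt h3D h9N`
with the index certificate `hIdx` (x10b `heegidx`, two engines; X10B-HEEGIDX.md); `hq`/`hv` (`#Ш_an = 9·unit`). Per pair; closes nothing new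
(the lane's Cha records `Theorems/Rank1ResidualX10bHeegnerIndexRecords.lean` carry the same pair with BOTH certificates); nothing booked; N2 mark
unchanged. [cite: Miller2011LMS, Thm. 5.2 and Def. 1.1] [cite: SilvermanAEC2009, Thm. X.4.14 and App. C §11] [cite: Fisher2012Hessian, §13] [cite: Cremona2006, Table 1 (label 322624k1)] -/
theorem bsdp_three_selfTwist_cha_kernel_v322624k1
    (hGZK : rank_eq_analyticRank_of_analyticRank_le_one)
    (hCT : exists_casselsTate_pairing (K := ℚ)) (hCha : Cha2005.thm52_padicValNat_shaOrder_le)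
    (W : WeierstrassCurve ℚ) [W.IsElliptic] [W.IsGloballyMinimal]
    (hI : integralModelInt W = ⟨0, -1, 0, -45335393, -116524739615⟩) (hr : W.analyticRank = 0)
    {N : ℕ} [NeZero N] {K : Type} [Field K] [NumberField K] (hK : IsImaginaryQuadratic K)
    (hH : SatisfiesHeegnerHypothesis N K) {P : (W.baseChange K).toAffine.Point}
    (hP : IsHeegnerPoint N W K P) (hnt : ¬ IsOfFinAddOrder P)
    (h3D : ¬ (3 : ℤ) ∣ NumberField.discr K) (h9N : ¬ 3 ^ 2 ∣ N)
    (hIdx : padicValNat 3 (AddSubgroup.zmultiples P).index ≤ 1)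
    {q : ℚ} (hq : shaAn W = (q : ℂ)) (hv : padicValRat 3 q = 2) :
    BSDp W 3 := by
  haveI : Fact (Nat.Prime 2) := ⟨Nat.prime_two⟩
  have hirr : W.HasIrreducibleModPGaloisRep 3 := irr3_v322624k1 hI
  have hcm : ¬ W.HasCM :=
    AdditivePotMult.not_hasCM_of_padicValRat_j_neg
      (AdditivePotMult.padicValRat_j_lt_zero_of_intModel hI 2 18 (by decide +kernel) (by decide +kernel))
  have hvis := exists_sha_three_selfTwist_kernel_v322624k1  hGZK W hI hr
  exact Typed.bsdp_of_cha_of_casselsTate_of_dvd W 3 hGZK hCT hCha hcm (by rw [hr]; norm_num) hK hH hP hnt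
    (by decide) h3D h9N hirr (k := 1) hIdx hq (by rw [hv]; norm_num)
    (by simpa using dvd_shaOrder_of_exists_torsion W 3 hvis)

/-- **`ord₃ #Ш(322624k1) = 2` exactly** under the same data (Cha's upper bound from the index certificate; the lower bound IN THE KERNEL from the
self-twist visibility record and Cassels–Tate). [cite: Miller2011LMS, Thm. 5.2] [cite: SilvermanAEC2009, Thm. X.4.14] -/
theorem padicValNat_shaOrder_eq_two_selfTwist_cha_kernel_v322624k1
    (hGZK : rank_eq_analyticRank_of_analyticRank_le_one)
    (hCT : exists_casselsTate_pairing (K := ℚ)) (hCha : Cha2005.thm52_padicValNat_shaOrder_le)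
    (W : WeierstrassCurve ℚ) [W.IsElliptic] [W.IsGloballyMinimal]
    (hI : integralModelInt W = ⟨0, -1, 0, -45335393, -116524739615⟩) (hr : W.analyticRank = 0)
    {N : ℕ} [NeZero N] {K : Type} [Field K] [NumberField K] (hK : IsImaginaryQuadratic K)
    (hH : SatisfiesHeegnerHypothesis N K) {P : (W.baseChange K).toAffine.Point}
    (hP : IsHeegnerPoint N W K P) (hnt : ¬ IsOfFinAddOrder P)
    (h3D : ¬ (3 : ℤ) ∣ NumberField.discr K) (h9N : ¬ 3 ^ 2 ∣ N)
    (hIdx : padicValNat 3 (AddSubgroup.zmultiples P).index ≤ 1) :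
    padicValNat 3 W.shaOrder = 2 := by
  haveI : Fact (Nat.Prime 2) := ⟨Nat.prime_two⟩
  have hirr : W.HasIrreducibleModPGaloisRep 3 := irr3_v322624k1 hI
  have hcm : ¬ W.HasCM :=
    AdditivePotMult.not_hasCM_of_padicValRat_j_neg
      (AdditivePotMult.padicValRat_j_lt_zero_of_intModel hI 2 18 (by decide +kernel) (by decide +kernel))
  have hvis := exists_sha_three_selfTwist_kernel_v322624k1  hGZK W hI hr
  simpa using Typed.padicValNat_shaOrder_eq_of_cha_of_casselsTate_of_dvd W 3 hGZK hCT hCha hcm (by rw [hr]; norm_num) hK hH hP hnt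
    (by decide) h3D h9N hirr (k := 1) hIdx (by simpa using dvd_shaOrder_of_exists_torsion W 3 hvis)

/-! ### `305762d1` — BSD(E,3) by the Cha route with the descent line replaced by the kernel visibility theorem (`ord_2 j(E) < 0` ⇒ non-CM) -/

/-- **`BSD(E,3)` for the N2 self-twist Ш-cell `305762d1` from ONE finite certificate (the Heegner index) — the `3`-descent line is NO
LONGER an input**: `Typed.bsdp_of_cha_of_casselsTate_of_dvd` (Cha 2005 / Miller 2011 Thm. 5.2 upper bound from
`ord₃ [E(K) : ℤ·y_K] ≤ 1`; Cassels–Tate lower bound from `3 ∣ #Ш(E)`) with `3 ∣ #Ш(E)` SUPPLIED IN THE KERNEL by the θ-free,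
rank-in-kernel visibility record `exists_sha_three_selfTwist_kernel_v305762d1` (`X10/SelfTwistThetaFreeRecordsE.lean`, x10 GEN 23), `E[3]`
irreducible by the record's Frobenius counts, and `E` non-CM because `ord_2 j(E) < 0` (`AdditivePotMult.not_hasCM_of_padicValRat_j_neg`,
kernel). Binders left (displayed): `hU` `hU2` (Tate uniformisation, PUBLISHED); PUBLISHED `hGZK` `hCT` `hCha`; the class condition `hr`; the Heegner datum `hK hH hP hnt h3D h9N`
with the index certificate `hIdx` (x10b `heegidx`, two engines; X10B-HEEGIDX.md); `hq`/`hv` (`#Ш_an = 9·unit`). Per pair; closes nothing new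
(the lane's Cha records `Theorems/Rank1ResidualX10bHeegnerIndexRecords.lean` carry the same pair with BOTH certificates); nothing booked; N2 mark
unchanged. [cite: Miller2011LMS, Thm. 5.2 and Def. 1.1] [cite: SilvermanAEC2009, Thm. X.4.14 and App. C §11] [cite: Fisher2012Hessian, §13] [cite: Cremona2006, Table 1 (label 305762d1)] -/
theorem bsdp_three_selfTwist_cha_kernel_v305762d1
    (hU : Silverman1994_thmV53_tateUniformisation.{0}) (hU2 : Silverman1994_thmV53_corV54_tateUniformisation.{0})
    (hGZK : rank_eq_analyticRank_of_analyticRank_le_one)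
    (hCT : exists_casselsTate_pairing (K := ℚ)) (hCha : Cha2005.thm52_padicValNat_shaOrder_le)
    (W : WeierstrassCurve ℚ) [W.IsElliptic] [W.IsGloballyMinimal]
    (hI : integralModelInt W = ⟨1, 1, 0, -165191105, -959737799051⟩) (hr : W.analyticRank = 0)
    {N : ℕ} [NeZero N] {K : Type} [Field K] [NumberField K] (hK : IsImaginaryQuadratic K)
    (hH : SatisfiesHeegnerHypothesis N K) {P : (W.baseChange K).toAffine.Point}
    (hP : IsHeegnerPoint N W K P) (hnt : ¬ IsOfFinAddOrder P)
    (h3D : ¬ (3 : ℤ) ∣ NumberField.discr K) (h9N : ¬ 3 ^ 2 ∣ N)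
    (hIdx : padicValNat 3 (AddSubgroup.zmultiples P).index ≤ 1)
    {q : ℚ} (hq : shaAn W = (q : ℂ)) (hv : padicValRat 3 q = 2) :
    BSDp W 3 := by
  haveI : Fact (Nat.Prime 2) := ⟨Nat.prime_two⟩
  have hirr : W.HasIrreducibleModPGaloisRep 3 := irr3_v305762d1 hI
  have hcm : ¬ W.HasCM :=
    AdditivePotMult.not_hasCM_of_padicValRat_j_neg
      (AdditivePotMult.padicValRat_j_lt_zero_of_intModel hI 2 0 (by decide +kernel) (by decide +kernel))
  have hvis := exists_sha_three_selfTwist_kernel_v305762d1 hU hU2 hGZK W hI hr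
  exact Typed.bsdp_of_cha_of_casselsTate_of_dvd W 3 hGZK hCT hCha hcm (by rw [hr]; norm_num) hK hH hP hnt
    (by decide) h3D h9N hirr (k := 1) hIdx hq (by rw [hv]; norm_num)
    (by simpa using dvd_shaOrder_of_exists_torsion W 3 hvis)

/-- **`ord₃ #Ш(305762d1) = 2` exactly** under the same data (Cha's upper bound from the index certificate; the lower bound IN THE KERNEL from the
self-twist visibility record and Cassels–Tate). [cite: Miller2011LMS, Thm. 5.2] [cite: SilvermanAEC2009, Thm. X.4.14] -/
theorem padicValNat_shaOrder_eq_two_selfTwist_cha_kernel_v305762d1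
    (hU : Silverman1994_thmV53_tateUniformisation.{0}) (hU2 : Silverman1994_thmV53_corV54_tateUniformisation.{0})
    (hGZK : rank_eq_analyticRank_of_analyticRank_le_one)
    (hCT : exists_casselsTate_pairing (K := ℚ)) (hCha : Cha2005.thm52_padicValNat_shaOrder_le)
    (W : WeierstrassCurve ℚ) [W.IsElliptic] [W.IsGloballyMinimal]
    (hI : integralModelInt W = ⟨1, 1, 0, -165191105, -959737799051⟩) (hr : W.analyticRank = 0)
    {N : ℕ} [NeZero N] {K : Type} [Field K] [NumberField K] (hK : IsImaginaryQuadratic K)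
    (hH : SatisfiesHeegnerHypothesis N K) {P : (W.baseChange K).toAffine.Point}
    (hP : IsHeegnerPoint N W K P) (hnt : ¬ IsOfFinAddOrder P)
    (h3D : ¬ (3 : ℤ) ∣ NumberField.discr K) (h9N : ¬ 3 ^ 2 ∣ N)
    (hIdx : padicValNat 3 (AddSubgroup.zmultiples P).index ≤ 1) :
    padicValNat 3 W.shaOrder = 2 := by
  haveI : Fact (Nat.Prime 2) := ⟨Nat.prime_two⟩
  have hirr : W.HasIrreducibleModPGaloisRep 3 := irr3_v305762d1 hI
  have hcm : ¬ W.HasCM :=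
    AdditivePotMult.not_hasCM_of_padicValRat_j_neg
      (AdditivePotMult.padicValRat_j_lt_zero_of_intModel hI 2 0 (by decide +kernel) (by decide +kernel))
  have hvis := exists_sha_three_selfTwist_kernel_v305762d1 hU hU2 hGZK W hI hr
  simpa using Typed.padicValNat_shaOrder_eq_of_cha_of_casselsTate_of_dvd W 3 hGZK hCT hCha hcm (by rw [hr]; norm_num) hK hH hP hnt
    (by decide) h3D h9N hirr (k := 1) hIdx (by simpa using dvd_shaOrder_of_exists_torsion W 3 hvis)

end Summit.BirchSwinnertonDyer.Rank1Residual.X10.SelfTwist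

end
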